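import Mathlib
import Literature.MathematicalPhysics.QuantumLattice.WilsonDiracAP
import Literature.MathematicalPhysics.QuantumLattice.OverlapLocality
import Literature.MathematicalPhysics.QuantumLattice.SpectralLocalizer
import Literature.MathematicalPhysics.QuantumFieldTheory.LatticeGaugeStringTensionProofs
import HarnessLib

/-!
# Hypercubic covariance of the Wilson action; spin and site algebra of the axis exchange
(auxiliary file for stub `stub_axisSwap` of crux stmt-QuantumFields-9735, line Sketch)

For the exchange `σ = (0 i)` of the time axis with the axis `i` of the four-torus, acting on a
lattice gauge field by `(σU)(x, j) = U(x ∘ σ, σ j)`: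

* Spin algebra: the invertible spin matrix `S_i = γ₅ (γ₀ - γ_i)` realises the transposition on the
  Euclidean Clifford generators, `S_i γ_ν = γ_{σν} S_i` for `i ≠ 0` (`spinS_mul_euclideanGamma`),
  with inverse `S_i⁻¹ = ½ (γ₀ - γ_i) γ₅` (`spinS_mul_spinS'`); hence it conjugates the Wilson
  hopping projectors `½(1 ∓ γ_ν)` into `½(1 ∓ γ_{σν})` (`spinS_conj_chiralProjMinus/Plus`).
  Throughout, `S_i` and `S_i⁻¹` are written out as
  `gammaFive * (euclideanGamma 0 - euclideanGamma i)` and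
  `(2 : ℂ)⁻¹ • ((euclideanGamma 0 - euclideanGamma i) * gammaFive)`.
* Site algebra: `x ↦ x ∘ σ` is an involution of the torus carrying `x + ê_μ` to `x ∘ σ + ê_{σμ}`.
* `S_W(σU) = S_W(U)` for the Wilson action of any continuous representation of a compact group:
  a plaquette goes to a plaquette, possibly traversed backwards, and `Re tr ρ(g⁻¹) = Re tr ρ(g)`
  (`wilsonAction_swap`, the `1 ↦ i` generalisation of the tree's
  `StringTension.wilsonAction_swap`).

The main theorem of this file is the `SU(3)` specialisation `stub_axisSwap_action` (the
Wilson-action half of the stub); the determinant half (`det D_AP[σU] = det D_AP[U]`) is in the main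
stub file, which uses the spin and site algebra of this one.

References: K. Osterwalder, E. Seiler, Ann. Phys. 110 (1978) 440, §2; I. Montvay, G. Münster,
*Quantum Fields on a Lattice* (CUP 1994), §4.2 and App. 8.1.2.
-/

noncomputable section

open MeasureTheory Matrix Complex Finset
open Literature.MathematicalPhysics.QuantumFieldTheory Literature.MathematicalPhysics.QuantumLattice
open Literature.Probability.LatticeModels
open scoped ComplexConjugate BigOperators ComplexOrder Kronecker

namespace Summit.QuantumFields.QCD.Theorems.UnquenchedChessboardBoundLine

namespace AxisSwap

/-! ## Spin algebra: `S_i = γ₅ (γ₀ - γ_i)` realises the transposition `(0 i)` on the `γ_μ` -/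

section Spin

/-- `γ_μ γ₅ = -γ₅ γ_μ`. -/
theorem euclideanGamma_mul_gammaFive_eq (μ : Fin 4) :
    euclideanGamma μ * gammaFive = -(gammaFive * euclideanGamma μ) := by
  rw [gammaFive_mul_euclideanGamma, neg_neg]

/-- `S_i` commutes with `γ_ν` for `ν ∉ {0, i}`. -/
theorem spinS_mul_of_ne_of_ne {i ν : Fin 4} (hν0 : ν ≠ 0) (hνi : ν ≠ i) :
    gammaFive * (euclideanGamma 0 - euclideanGamma i) * euclideanGamma ν =
      euclideanGamma ν * (gammaFive * (euclideanGamma 0 - euclideanGamma i)) := by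
  have h0 : euclideanGamma 0 * euclideanGamma ν = -(euclideanGamma ν * euclideanGamma 0) :=
    euclideanGamma_mul_of_ne (Ne.symm hν0)
  have hi : euclideanGamma i * euclideanGamma ν = -(euclideanGamma ν * euclideanGamma i) :=
    euclideanGamma_mul_of_ne (Ne.symm hνi)
  calc gammaFive * (euclideanGamma 0 - euclideanGamma i) * euclideanGamma ν
      = gammaFive *
          (euclideanGamma 0 * euclideanGamma ν - euclideanGamma i * euclideanGamma ν) := by
        rw [Matrix.mul_assoc, Matrix.sub_mul]
    _ = gammaFive *
          (-(euclideanGamma ν * euclideanGamma 0) - -(euclideanGamma ν * euclideanGamma i)) := by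
        rw [h0, hi]
    _ = -(gammaFive * euclideanGamma ν) * (euclideanGamma 0 - euclideanGamma i) := by noncomm_ring
    _ = euclideanGamma ν * gammaFive * (euclideanGamma 0 - euclideanGamma i) := by
        rw [← euclideanGamma_mul_gammaFive_eq]
    _ = euclideanGamma ν * (gammaFive * (euclideanGamma 0 - euclideanGamma i)) :=
        Matrix.mul_assoc _ _ _

/-- `S_i γ₀ = γ_i S_i`. -/
theorem spinS_mul_zero {i : Fin 4} (hi : i ≠ 0) :
    gammaFive * (euclideanGamma 0 - euclideanGamma i) * euclideanGamma 0 =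
      euclideanGamma i * (gammaFive * (euclideanGamma 0 - euclideanGamma i)) := by
  have hi0 : euclideanGamma i * euclideanGamma 0 = -(euclideanGamma 0 * euclideanGamma i) :=
    euclideanGamma_mul_of_ne hi
  symm
  calc euclideanGamma i * (gammaFive * (euclideanGamma 0 - euclideanGamma i))
      = -(gammaFive *
          (euclideanGamma i * euclideanGamma 0 - euclideanGamma i * euclideanGamma i)) := by
        rw [← Matrix.mul_assoc, euclideanGamma_mul_gammaFive_eq, Matrix.neg_mul, Matrix.mul_assoc,
          Matrix.mul_sub]
    _ = -(gammaFive * (-(euclideanGamma 0 * euclideanGamma i) - 1)) := by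
        rw [hi0, euclideanGamma_mul_self]
    _ = gammaFive * (1 - -(euclideanGamma 0 * euclideanGamma i)) := by noncomm_ring
    _ = gammaFive * (euclideanGamma 0 - euclideanGamma i) * euclideanGamma 0 := by
        rw [Matrix.mul_assoc, Matrix.sub_mul, euclideanGamma_mul_self, hi0]

/-- `S_i γ_i = γ₀ S_i`. -/
theorem spinS_mul_idx (i : Fin 4) :
    gammaFive * (euclideanGamma 0 - euclideanGamma i) * euclideanGamma i =
      euclideanGamma 0 * (gammaFive * (euclideanGamma 0 - euclideanGamma i)) := by
  symm
  calc euclideanGamma 0 * (gammaFive * (euclideanGamma 0 - euclideanGamma i))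
      = -(gammaFive *
          (euclideanGamma 0 * euclideanGamma 0 - euclideanGamma 0 * euclideanGamma i)) := by
        rw [← Matrix.mul_assoc, euclideanGamma_mul_gammaFive_eq, Matrix.neg_mul, Matrix.mul_assoc,
          Matrix.mul_sub]
    _ = -(gammaFive * (1 - euclideanGamma 0 * euclideanGamma i)) := by rw [euclideanGamma_mul_self]
    _ = gammaFive * (euclideanGamma 0 * euclideanGamma i - 1) := by noncomm_ring
    _ = gammaFive * (euclideanGamma 0 - euclideanGamma i) * euclideanGamma i := by
        rw [Matrix.mul_assoc, Matrix.sub_mul, euclideanGamma_mul_self]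

/-- **`S_i` realises the transposition `(0 i)` on the Clifford generators**:
`S_i γ_ν = γ_{σ ν} S_i` for `σ = (0 i)`, `i ≠ 0`. -/
theorem spinS_mul_euclideanGamma {i : Fin 4} (hi : i ≠ 0) (ν : Fin 4) :
    gammaFive * (euclideanGamma 0 - euclideanGamma i) * euclideanGamma ν =
      euclideanGamma (Equiv.swap (0 : Fin 4) i ν) *
        (gammaFive * (euclideanGamma 0 - euclideanGamma i)) := by
  by_cases hν0 : ν = 0
  · subst hν0
    rw [Equiv.swap_apply_left]
    exact spinS_mul_zero hi
  · by_cases hνi : ν = i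
    · subst hνi
      rw [Equiv.swap_apply_right]
      exact spinS_mul_idx ν
    · rw [Equiv.swap_apply_of_ne_of_ne hν0 hνi]
      exact spinS_mul_of_ne_of_ne hν0 hνi

/-- `S_i S_i⁻¹ = 1` with `S_i⁻¹ = ½ (γ₀ - γ_i) γ₅` (`(γ₀ - γ_i)² = 2`, `γ₅² = 1`), `i ≠ 0`. -/
theorem spinS_mul_spinS' {i : Fin 4} (hi : i ≠ 0) :
    gammaFive * (euclideanGamma 0 - euclideanGamma i) *
      ((2 : ℂ)⁻¹ • ((euclideanGamma 0 - euclideanGamma i) * gammaFive)) = 1 := by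
  have hi0 : euclideanGamma i * euclideanGamma 0 = -(euclideanGamma 0 * euclideanGamma i) :=
    euclideanGamma_mul_of_ne hi
  have hT : (euclideanGamma 0 - euclideanGamma i) * (euclideanGamma 0 - euclideanGamma i) =
      (2 : ℂ) • (1 : Matrix (Fin 4) (Fin 4) ℂ) := by
    rw [Matrix.sub_mul, Matrix.mul_sub, Matrix.mul_sub, euclideanGamma_mul_self,
      euclideanGamma_mul_self, hi0, two_smul]
    abel
  calc gammaFive * (euclideanGamma 0 - euclideanGamma i) *
        ((2 : ℂ)⁻¹ • ((euclideanGamma 0 - euclideanGamma i) * gammaFive))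
      = (2 : ℂ)⁻¹ • (gammaFive * ((euclideanGamma 0 - euclideanGamma i) *
          (euclideanGamma 0 - euclideanGamma i)) * gammaFive) := by
        rw [Matrix.mul_smul]
        simp only [Matrix.mul_assoc]
    _ = 1 := by
        rw [hT, Matrix.mul_smul, Matrix.mul_one, Matrix.smul_mul, gammaFive_mul_self, smul_smul,
          inv_mul_cancel₀ two_ne_zero, one_smul]

/-- Conjugating `c (1 - Γ)` by an invertible `T` with `T Γ = Γ' T` gives `c (1 - Γ')`. -/
theorem conj_smul_one_sub {n : Type*} [Fintype n] [DecidableEq n] (T T' Γ Γ' : Matrix n n ℂ)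
    (hTT : T * T' = 1) (h : T * Γ = Γ' * T) (c : ℂ) :
    T * (c • (1 - Γ)) * T' = c • (1 - Γ') := by
  rw [Matrix.mul_smul, Matrix.smul_mul, Matrix.mul_sub, Matrix.sub_mul, Matrix.mul_one, hTT, h,
    Matrix.mul_assoc, hTT, Matrix.mul_one]

/-- Conjugating `c (1 + Γ)` by an invertible `T` with `T Γ = Γ' T` gives `c (1 + Γ')`. -/
theorem conj_smul_one_add {n : Type*} [Fintype n] [DecidableEq n] (T T' Γ Γ' : Matrix n n ℂ)
    (hTT : T * T' = 1) (h : T * Γ = Γ' * T) (c : ℂ) :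
    T * (c • (1 + Γ)) * T' = c • (1 + Γ') := by
  rw [Matrix.mul_smul, Matrix.smul_mul, Matrix.mul_add, Matrix.add_mul, Matrix.mul_one, hTT, h,
    Matrix.mul_assoc, hTT, Matrix.mul_one]

/-- Conjugation by `S_i` permutes the hopping projectors: `S_i P⁻_ν S_i⁻¹ = P⁻_{σ ν}`. -/
theorem spinS_conj_chiralProjMinus {i : Fin 4} (hi : i ≠ 0) (ν : Fin 4) :
    gammaFive * (euclideanGamma 0 - euclideanGamma i) * chiralProjMinus ν *
        ((2 : ℂ)⁻¹ • ((euclideanGamma 0 - euclideanGamma i) * gammaFive)) =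
      chiralProjMinus (Equiv.swap (0 : Fin 4) i ν) := by
  unfold chiralProjMinus
  exact conj_smul_one_sub _ _ _ _ (spinS_mul_spinS' hi) (spinS_mul_euclideanGamma hi ν) _

/-- `S_i P⁺_ν S_i⁻¹ = P⁺_{σ ν}`. -/
theorem spinS_conj_chiralProjPlus {i : Fin 4} (hi : i ≠ 0) (ν : Fin 4) :
    gammaFive * (euclideanGamma 0 - euclideanGamma i) * chiralProjPlus ν *
        ((2 : ℂ)⁻¹ • ((euclideanGamma 0 - euclideanGamma i) * gammaFive)) =
      chiralProjPlus (Equiv.swap (0 : Fin 4) i ν) := by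
  unfold chiralProjPlus
  exact conj_smul_one_add _ _ _ _ (spinS_mul_spinS' hi) (spinS_mul_euclideanGamma hi ν) _

end Spin

/-! ## Sites under the coordinate exchange `x ↦ x ∘ σ` -/

section Sites

variable {L : ℕ}

/-- `x ↦ x ∘ σ` is an involution (`σ = (0 i)` is). -/
theorem comp_swap_comp_swap (i : Fin 4) (x : TorusSite 4 L) :
    (x ∘ ⇑(Equiv.swap (0 : Fin 4) i)) ∘ ⇑(Equiv.swap (0 : Fin 4) i) = x :=
  funext fun k => by simp only [Function.comp_apply, Equiv.swap_apply_self]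

/-- `x ↦ x ∘ σ` is an involution of the sites of the four-torus. -/
theorem comp_swap_involutive (i : Fin 4) :
    Function.Involutive (fun x : TorusSite 4 L => x ∘ ⇑(Equiv.swap (0 : Fin 4) i)) :=
  fun x => comp_swap_comp_swap i x

/-- Permuting coordinates commutes with displacements:
`(x + c e_μ) ∘ σ = x ∘ σ + c e_{σ μ}`. -/
theorem comp_swap_add_single (x : TorusSite 4 L) (i μ : Fin 4) (c : ZMod L) :
    (x + Pi.single μ c) ∘ ⇑(Equiv.swap (0 : Fin 4) i) =
      x ∘ ⇑(Equiv.swap (0 : Fin 4) i) + Pi.single (Equiv.swap (0 : Fin 4) i μ) c := by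
  -- adapted from `StringTension.comp_swap_add_single`
  -- (Literature.MathematicalPhysics.QuantumFieldTheory.LatticeGaugeStringTensionProofs)
  funext k
  simp only [Function.comp_apply, Pi.add_apply]
  congr 1
  by_cases hk : Equiv.swap (0 : Fin 4) i k = μ
  · have hk' : k = Equiv.swap (0 : Fin 4) i μ := by rw [← hk, Equiv.swap_apply_self]
    rw [hk, hk', Pi.single_eq_same, Pi.single_eq_same]
  · have hk' : k ≠ Equiv.swap (0 : Fin 4) i μ := fun h => hk (by rw [h, Equiv.swap_apply_self])
    rw [Pi.single_eq_of_ne hk, Pi.single_eq_of_ne hk']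

/-- `(x + ê_μ) ∘ σ = x ∘ σ + ê_{σ μ}`. -/
theorem shift_comp_swap (i : Fin 4) (x : TorusSite 4 L) (μ : Fin 4) :
    Site.shift x μ ∘ ⇑(Equiv.swap (0 : Fin 4) i) =
      Site.shift (x ∘ ⇑(Equiv.swap (0 : Fin 4) i)) (Equiv.swap (0 : Fin 4) i μ) :=
  comp_swap_add_single x i μ 1

/-- The hop condition `y = x + ê_μ` in the exchanged coordinates. -/
theorem eq_shift_iff_comp_swap (i : Fin 4) (x y : TorusSite 4 L) (μ : Fin 4) :
    y = Site.shift x μ ↔ y ∘ ⇑(Equiv.swap (0 : Fin 4) i) =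
      Site.shift (x ∘ ⇑(Equiv.swap (0 : Fin 4) i)) (Equiv.swap (0 : Fin 4) i μ) := by
  rw [← shift_comp_swap]
  constructor
  · intro h
    rw [h]
  · intro h
    have h2 := congrArg (fun z : TorusSite 4 L => z ∘ ⇑(Equiv.swap (0 : Fin 4) i)) h
    simpa only [comp_swap_comp_swap] using h2

end Sites

/-! ## The Wilson action under the coordinate exchange -/

section Action

open Literature.RepresentationTheory.CompactGroups

variable {L N : ℕ} {G : Type*} [Group G]

/-- Plaquette holonomies of the coordinate-exchanged configuration. -/
theorem plaquetteHolonomy_swap (U : GaugeConfig 4 L G) (i : Fin 4) (x : Site 4 L) (a b : Fin 4) :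
    plaquetteHolonomy (fun e : Edge 4 L =>
        U (e.1 ∘ ⇑(Equiv.swap (0 : Fin 4) i), Equiv.swap (0 : Fin 4) i e.2)) x a b =
      plaquetteHolonomy U (x ∘ ⇑(Equiv.swap (0 : Fin 4) i)) (Equiv.swap (0 : Fin 4) i a)
        (Equiv.swap (0 : Fin 4) i b) := by
  -- adapted from `StringTension.plaquetteHolonomy_swap`
  -- (Literature.MathematicalPhysics.QuantumFieldTheory.LatticeGaugeStringTensionProofs)
  simp only [plaquetteHolonomy, shift_comp_swap]

/-- The exchange of the two directions of a plaquette index (`σ a`, `σ b` reordered). -/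
theorem swap_lt_or_lt {i a b : Fin 4} (h : a < b) :
    Equiv.swap (0 : Fin 4) i a < Equiv.swap (0 : Fin 4) i b ∨
      Equiv.swap (0 : Fin 4) i b < Equiv.swap (0 : Fin 4) i a := by
  rcases lt_trichotomy (Equiv.swap (0 : Fin 4) i a) (Equiv.swap (0 : Fin 4) i b) with h' | h' | h'
  · exact Or.inl h'
  · exact absurd ((Equiv.swap (0 : Fin 4) i).injective h') (ne_of_lt h)
  · exact Or.inr h'

/-- **The Wilson action is invariant under the coordinate exchange** (a plaquette goes to a
plaquette, possibly traversed backwards; `Re tr ρ(g⁻¹) = Re tr ρ(g)` for a continuous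
representation of a compact group). -/
theorem wilsonAction_swap [NeZero L] [TopologicalSpace G] [IsTopologicalGroup G] [CompactSpace G]
    (ρ : G →* Matrix (Fin N) (Fin N) ℂ) (hρ : Continuous ρ) (U : GaugeConfig 4 L G) (i : Fin 4) :
    wilsonAction ρ (fun e : Edge 4 L =>
        U (e.1 ∘ ⇑(Equiv.swap (0 : Fin 4) i), Equiv.swap (0 : Fin 4) i e.2)) =
      wilsonAction ρ U := by
  -- adapted from Literature.MathematicalPhysics.QuantumFieldTheory.StringTension.wilsonAction_swap
  have hne : ∀ q : {p : Fin 4 × Fin 4 // p.1 < p.2},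
      ¬ Equiv.swap (0 : Fin 4) i q.1.1 < Equiv.swap (0 : Fin 4) i q.1.2 →
        Equiv.swap (0 : Fin 4) i q.1.2 < Equiv.swap (0 : Fin 4) i q.1.1 :=
    fun q h => (swap_lt_or_lt q.2).resolve_left h
  set f : Plaquette 4 L → Plaquette 4 L := fun p =>
    (p.1 ∘ ⇑(Equiv.swap (0 : Fin 4) i),
      if h : Equiv.swap (0 : Fin 4) i p.2.1.1 < Equiv.swap (0 : Fin 4) i p.2.1.2 then
        ⟨(Equiv.swap (0 : Fin 4) i p.2.1.1, Equiv.swap (0 : Fin 4) i p.2.1.2), h⟩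
      else ⟨(Equiv.swap (0 : Fin 4) i p.2.1.2, Equiv.swap (0 : Fin 4) i p.2.1.1), hne p.2 h⟩)
    with hf
  have hinv : Function.Involutive f := by
    intro p
    obtain ⟨x, ⟨⟨a, b⟩, hab⟩⟩ := p
    simp only [hf]
    refine Prod.ext (comp_swap_comp_swap i x) ?_
    by_cases h : Equiv.swap (0 : Fin 4) i a < Equiv.swap (0 : Fin 4) i b
    · simp only [h, ↓reduceDIte, Equiv.swap_apply_self, hab]
    · simp only [h, ↓reduceDIte, Equiv.swap_apply_self, dif_neg (lt_asymm hab)]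
  unfold wilsonAction
  refine Finset.sum_equiv (Function.Involutive.toPerm f hinv) (fun p => by simp) fun p _ => ?_
  obtain ⟨x, ⟨⟨a, b⟩, hab⟩⟩ := p
  simp only [Function.Involutive.coe_toPerm, hf]
  rw [plaquetteHolonomy_swap]
  by_cases h : Equiv.swap (0 : Fin 4) i a < Equiv.swap (0 : Fin 4) i b
  · simp only [h, ↓reduceDIte]
  · simp only [h, ↓reduceDIte]
    rw [StringTension.plaquetteHolonomy_symm U _ (Equiv.swap (0 : Fin 4) i b)
        (Equiv.swap (0 : Fin 4) i a), CompactGroup.re_trace_map_inv ρ hρ]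

end Action

end AxisSwap

/-! ## Main theorem of this auxiliary file: the Wilson-action half of `stub_axisSwap` -/

/-- **Hypercubic covariance of the `SU(3)` Wilson action** (the second conjunct of
`stub_axisSwap`): exchanging the time axis with the axis `i` on sites and directions leaves
`S_W` invariant. -/
theorem stub_axisSwap_action {L : ℕ} [NeZero L] (i : Fin 4)
    (U : GaugeConfig 4 L (Matrix.specialUnitaryGroup (Fin 3) ℂ)) :
    wilsonAction (fundamentalRep (Fin 3)) (fun e : Edge 4 L =>
        U (e.1 ∘ Equiv.swap (0 : Fin 4) i, Equiv.swap (0 : Fin 4) i e.2)) =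
      wilsonAction (fundamentalRep (Fin 3)) U :=
  AxisSwap.wilsonAction_swap (fundamentalRep (Fin 3)) (continuous_fundamentalRep (Fin 3)) U i

end Summit.QuantumFields.QCD.Theorems.UnquenchedChessboardBoundLine

end
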